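import Mathlib
import Summits.KontsevichZagierPeriods.KontsevichZagierPeriods.Theorems.SoloInformedBoxCube
import Summits.KontsevichZagierPeriods.KontsevichZagierPeriods.Theorems.SoloInformedHesseChambers
import Literature.NumberTheory.Transcendental.KZCalculus
import Literature.NumberTheory.Transcendental.KZSemiCanonicalReductionProofs
import Literature.NumberTheory.Transcendental.KZSemialgebraicComplex
import Literature.NumberTheory.Transcendental.SemialgebraicMapsProofs
import Literature.NumberTheory.Transcendental.SemialgebraicVolume
import HarnessLib
import HarnessLib.Audit

/-!
# SoloInformed — Gauss triplication by the moves, VII: symmetrising the box side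

From `R′ = [(0,1)², 9Y·c^{s−1}]`, `c = (1−X³)(1−Y³)`, three moves produce the SYMMETRIC
half-box representation `U = [H₁, 9(X+Y)·c^{s−1}]`, `H₁ = {0 < X < Y < 1}`:
split `(0,1)²` at the (null) diagonal into `H₁ ⊔ H₂` (rule (1a)), carry `[H₂, 9Y c^{s−1}]` to
`W = [H₁, 9X c^{s−1}]` by the swap `(X,Y) ↦ (Y,X)` (rule (2)), and add integrands on `H₁`
(rule (1b)). All intermediate representations exist (`W` by domination `X ≤ Y` on `H₁`).
Main statement: `soloInformed_boxChain` — the cube Beta representation is equivalent to every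
representation pinned as `U`; `soloInformed_exists_U`.

Residency `solo-KontsevichZagierPeriods-informed` (s71); paper §7 (c6)(x).
References: Kontsevich–Zagier, *Periods* (2001), §1.2 rules (1), (2).
-/

noncomputable section

open MeasureTheory Set Filter
namespace Summit.KontsevichZagierPeriods.KontsevichZagierPeriods.Theorems

open Literature.NumberTheory.Transcendental Literature.NumberTheory.Transcendental.KZ
open Literature.ModelTheory.ExponentialFields

/-- The swapped weight `9 · X · c^{e}`. [this work] -/
def soloInformedBoxW (e : ℝ) (X : Fin 2 → ℝ) : ℝ := 9 * X 0 * soloInformedBoxC X ^ e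

/-- The symmetrised weight `9 · (X + Y) · c^{e}`. [this work] -/
def soloInformedBoxU (e : ℝ) (X : Fin 2 → ℝ) : ℝ := 9 * (X 0 + X 1) * soloInformedBoxC X ^ e

/-! ### Rule (1a): splitting the box at the diagonal -/

/-- The box minus its two open halves is Lebesgue-null (the diagonal). [this work] -/
theorem soloInformed_volume_box_diff_halves :
    volume (soloInformedUnitBox \ (soloInformedH1 ∪ soloInformedH2)) = 0 := by
  set q : MvPolynomial (Fin 2) ℚ := MvPolynomial.X 0 - MvPolynomial.X 1 with hq
  have hq0 : MvPolynomial.map (algebraMap ℚ ℝ) q ≠ 0 := by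
    intro h
    have := congrArg (MvPolynomial.eval ![(1:ℝ), 0]) h
    rw [MvPolynomial.eval_map, ← MvPolynomial.aeval_def] at this
    norm_num [hq] at this
  refine measure_mono_null (fun X hX => ?_) (volume_setOf_aeval_eq_zero q hq0)
  obtain ⟨hXb, hXU⟩ := hX
  obtain ⟨h0, h1, h2, h3⟩ := soloInformed_mem_box.1 hXb
  simp only [mem_setOf_eq, hq, map_sub, MvPolynomial.aeval_X]
  by_contra hne
  rcases lt_or_gt_of_ne (fun h : X 0 = X 1 => hne (by rw [h, sub_self])) with hlt | hlt
  · exact hXU (Or.inl ⟨h0, hlt, h3⟩)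
  · exact hXU (Or.inr ⟨h2, hlt, h1⟩)

/-- **Rule (1a) at the diagonal**: `[R′] − [R′|_{H₁}] − [R′|_{H₂}] ∈ KZ.relations`. [this work] -/
theorem soloInformed_boxSplit (R : IntegralRep 2) (hRd : R.domain = soloInformedUnitBox)
    (h1 : soloInformedH1 ⊆ R.domain) (h2 : soloInformedH2 ⊆ R.domain) :
    of R - of (R.restrict soloInformedH1 soloInformed_isSemialgebraic_H1 h1) -
      of (R.restrict soloInformedH2 soloInformed_isSemialgebraic_H2 h2) ∈ relations := by
  have hE : IsSemialgebraic ℚ (soloInformedH1 ∪ soloInformedH2) :=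
    soloInformed_isSemialgebraic_H1.union soloInformed_isSemialgebraic_H2
  have hEsub : soloInformedH1 ∪ soloInformedH2 ⊆ R.domain := union_subset h1 h2
  set RE := R.restrict _ hE hEsub with hRE
  have e1 : of R - of RE ∈ relations :=
    R.of_sub_of_restrict_mem_relations hE hEsub (by rw [hRd]; exact soloInformed_volume_box_diff_halves)
  have e2 : of RE - of (R.restrict soloInformedH1 soloInformed_isSemialgebraic_H1 h1) -
      of (R.restrict soloInformedH2 soloInformed_isSemialgebraic_H2 h2) ∈ relations := by
    refine domainAddRel_subset_relations ⟨2, RE, R.restrict soloInformedH1 soloInformed_isSemialgebraic_H1 h1,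
      R.restrict soloInformedH2 soloInformed_isSemialgebraic_H2 h2, rfl, ?_, fun _ _ => rfl, fun _ _ => rfl, rfl⟩
    rw [show (R.restrict soloInformedH1 soloInformed_isSemialgebraic_H1 h1).domain ∩
        (R.restrict soloInformedH2 soloInformed_isSemialgebraic_H2 h2).domain = ∅ from
      eq_empty_of_forall_notMem fun X ⟨⟨_, a, _⟩, ⟨_, b, _⟩⟩ => lt_asymm a b, measure_empty]
  have : of R - of (R.restrict soloInformedH1 soloInformed_isSemialgebraic_H1 h1) -
      of (R.restrict soloInformedH2 soloInformed_isSemialgebraic_H2 h2) = (of R - of RE) +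
      (of RE - of (R.restrict soloInformedH1 soloInformed_isSemialgebraic_H1 h1) -
        of (R.restrict soloInformedH2 soloInformed_isSemialgebraic_H2 h2)) := by abel
  rw [this]
  exact relations.add_mem e1 e2

/-! ### The swapped representation `W = [H₁, 9X c^e]` -/

/-- `c` is continuous. [this work] -/
theorem soloInformed_continuous_boxC : Continuous soloInformedBoxC := by
  unfold soloInformedBoxC; fun_prop

/-- **`W` exists** (domination by `R′|_{H₁}`: `X ≤ Y` on `H₁`). [this work] -/
theorem soloInformed_exists_W (s : ℚ) (R : IntegralRep 2) (hRd : R.domain = soloInformedUnitBox)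
    (hRi : EqOn R.integrand (soloInformedBoxR ((s:ℝ) - 1)) R.domain) :
    ∃ W : IntegralRep 2, W.domain = soloInformedH1 ∧ W.integrand = soloInformedBoxW ((s:ℝ) - 1) := by
  have h1 : soloInformedH1 ⊆ R.domain := by rw [hRd]; exact soloInformed_H1_subset_box
  have hg : IntegrableOn R.integrand soloInformedH1 := R.integrableOn.mono_set h1
  have hcont : ContinuousOn (soloInformedBoxW ((s:ℝ) - 1)) soloInformedH1 := by
    refine ((continuousOn_const.mul (continuous_apply 0).continuousOn)).mul
      (soloInformed_continuous_boxC.continuousOn.rpow_const fun X hX => Or.inl ?_)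
    exact (soloInformed_boxC_pos (soloInformed_H1_subset_box hX)).ne'
  have hint : IntegrableOn (soloInformedBoxW ((s:ℝ) - 1)) soloInformedH1 := by
    refine Integrable.mono' hg (hcont.aestronglyMeasurable soloInformed_measurableSet_H1) ?_
    refine (ae_restrict_iff' soloInformed_measurableSet_H1).2 (Eventually.of_forall fun X hX => ?_)
    have hc : 0 < soloInformedBoxC X ^ ((s:ℝ) - 1) :=
      Real.rpow_pos_of_pos (soloInformed_boxC_pos (soloInformed_H1_subset_box hX)) _
    obtain ⟨hx0, hxy, hy1⟩ := hX
    rw [hRi (h1 ⟨hx0, hxy, hy1⟩), Real.norm_eq_abs, soloInformedBoxW, soloInformedBoxR,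
      abs_of_nonneg (by positivity)]
    nlinarith
  have hsf : IsSemialgebraicFunOn ℚ soloInformedH1 (soloInformedBoxW ((s:ℝ) - 1)) := by
    refine (soloInformed_isSemialgebraicFunOn_boxWeight soloInformed_isSemialgebraic_H1 soloInformed_H1_subset_box
      (MvPolynomial.C 9 * MvPolynomial.X 0) (s - 1)).congr fun X _ => ?_
    simp [soloInformedBoxW]
  exact ⟨⟨_, _, soloInformed_isSemialgebraic_H1, hsf, hint⟩, rfl, rfl⟩

/-- `H₂` is the swap of `H₁`. [this work] -/
theorem soloInformed_image_swap_H1 : soloInformedChamberMap 1 '' soloInformedH1 = soloInformedH2 := by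
  ext X
  constructor
  · rintro ⟨u, ⟨a, b, c⟩, rfl⟩
    rw [(soloInformedChamberMap_eq u).2.1]
    refine ⟨?_, ?_, ?_⟩ <;> simp <;> assumption
  · rintro ⟨a, b, c⟩
    refine ⟨![X 1, X 0], ⟨by simpa using a, by simpa using b, by simpa using c⟩, ?_⟩
    rw [(soloInformedChamberMap_eq _).2.1]
    funext i; fin_cases i <;> simp

/-- **Rule (2) along the swap**: `[H₁, 9X c^e] ∼ [H₂, 9Y c^e]`. [this work] -/
theorem soloInformed_swapMove (e : ℝ) (W R₂ : IntegralRep 2) (hWd : W.domain = soloInformedH1)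
    (hWi : EqOn W.integrand (soloInformedBoxW e) W.domain) (hR₂d : R₂.domain = soloInformedH2)
    (hR₂i : EqOn R₂.integrand (soloInformedBoxR e) R₂.domain) : Equivalent W R₂ := by
  obtain ⟨hM, hc⟩ := soloInformed_isAlgebraic_chamber 1
  have hdet : (soloInformedChamberM 1).det ≠ 0 := by
    intro h; have := soloInformed_abs_det_chamberM 1; rw [h, abs_zero] at this; exact zero_ne_one this
  refine changeOfVariablesRel_subset_relations
    (soloInformed_affine_sub_mem_changeOfVariablesRel _ _ hM hc hdet W R₂ ?_ fun X hX => ?_)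
  · change R₂.domain = soloInformedChamberMap 1 '' W.domain
    rw [hWd, hR₂d, soloInformed_image_swap_H1]
  · have hX1 : X ∈ soloInformedH1 := by rw [← hWd]; exact hX
    have hsX : soloInformedChamberMap 1 X ∈ R₂.domain := by
      rw [hR₂d, ← soloInformed_image_swap_H1]; exact mem_image_of_mem _ hX1
    change W.integrand X = R₂.integrand (soloInformedChamberMap 1 X) * |(soloInformedChamberM 1).det|
    rw [hWi hX, hR₂i hsX, soloInformed_abs_det_chamberM, mul_one, (soloInformedChamberMap_eq X).2.1]
    simp only [soloInformedBoxW, soloInformedBoxR, soloInformedBoxC, Matrix.cons_val_zero, Matrix.cons_val_one]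
    ring

/-! ### Rule (1b): the symmetrised representation `U = [H₁, 9(X+Y) c^e]` -/

/-- **`U` exists.** [this work] -/
theorem soloInformed_exists_U (s : ℚ) (R : IntegralRep 2) (hRd : R.domain = soloInformedUnitBox)
    (hRi : EqOn R.integrand (soloInformedBoxR ((s:ℝ) - 1)) R.domain) :
    ∃ U : IntegralRep 2, U.domain = soloInformedH1 ∧ U.integrand = soloInformedBoxU ((s:ℝ) - 1) := by
  obtain ⟨W, hWd, hWi⟩ := soloInformed_exists_W s R hRd hRi
  have h1 : soloInformedH1 ⊆ R.domain := by rw [hRd]; exact soloInformed_H1_subset_box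
  have hint : IntegrableOn (soloInformedBoxU ((s:ℝ) - 1)) soloInformedH1 := by
    have hW : IntegrableOn W.integrand soloInformedH1 := hWd ▸ W.integrableOn
    refine ((R.integrableOn.mono_set h1).add hW).congr_fun (fun X hX => ?_) soloInformed_measurableSet_H1
    rw [Pi.add_apply, hRi (h1 hX), hWi]
    simp only [soloInformedBoxR, soloInformedBoxW, soloInformedBoxU]
    ring
  have hsf : IsSemialgebraicFunOn ℚ soloInformedH1 (soloInformedBoxU ((s:ℝ) - 1)) := by
    refine (soloInformed_isSemialgebraicFunOn_boxWeight soloInformed_isSemialgebraic_H1 soloInformed_H1_subset_box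
      (MvPolynomial.C 9 * (MvPolynomial.X 0 + MvPolynomial.X 1)) (s - 1)).congr fun X _ => ?_
    simp [soloInformedBoxU]
  exact ⟨⟨_, _, soloInformed_isSemialgebraic_H1, hsf, hint⟩, rfl, rfl⟩

/-- **The box side.** The cube Beta representation `[(0,1)², x^{-2/3}(1-x)^{s-1}y^{-1/3}(1-y)^{s-1}]`
is equivalent to every representation pinned as `U = [H₁, 9(X+Y)((1−X³)(1−Y³))^{s−1}]`: four moves
(cube roots, diagonal split, swap, integrand addition). [this work] -/
theorem soloInformed_boxChain (s : ℚ) (r U : IntegralRep 2) (hrd : r.domain = soloInformedUnitBox)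
    (hri : EqOn r.integrand (soloInformedCubeBeta ((s:ℝ) - 1)) r.domain) (hUd : U.domain = soloInformedH1)
    (hUi : EqOn U.integrand (soloInformedBoxU ((s:ℝ) - 1)) U.domain) : Equivalent r U := by
  obtain ⟨R, hRd, hRi⟩ := soloInformed_exists_cubeRootRep s r hrd hri
  have hRi' : EqOn R.integrand (soloInformedBoxR ((s:ℝ) - 1)) R.domain := fun X _ => by rw [hRi]
  obtain ⟨W, hWd, hWi⟩ := soloInformed_exists_W s R hRd hRi'
  have hWi' : EqOn W.integrand (soloInformedBoxW ((s:ℝ) - 1)) W.domain := fun X _ => by rw [hWi]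
  have h1 : soloInformedH1 ⊆ R.domain := by rw [hRd]; exact soloInformed_H1_subset_box
  have h2 : soloInformedH2 ⊆ R.domain := by rw [hRd]; exact soloInformed_H2_subset_box
  set R₁ := R.restrict soloInformedH1 soloInformed_isSemialgebraic_H1 h1 with hR₁
  set R₂ := R.restrict soloInformedH2 soloInformed_isSemialgebraic_H2 h2 with hR₂
  -- (i) cube roots
  have e0 : of r - of R ∈ relations := soloInformed_cubeRootMove _ r R hrd hri hRd hRi'
  -- (ii) diagonal split
  have e1 : of R - of R₁ - of R₂ ∈ relations := soloInformed_boxSplit R hRd h1 h2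
  -- (iii) swap
  have e2 : of W - of R₂ ∈ relations :=
    soloInformed_swapMove _ W R₂ hWd hWi' rfl fun X hX => hRi' (h2 hX)
  -- (iv) integrand addition on H₁
  have e3 : of U - of R₁ - of W ∈ relations := by
    refine integrandAddRel_subset_relations ⟨2, U, R₁, W, by rw [hUd]; rfl, by rw [hUd, hWd], fun X hX => ?_, rfl⟩
    have hX1 : X ∈ soloInformedH1 := by rw [← hUd]; exact hX
    rw [hUi hX, Pi.add_apply, hWi, show R₁.integrand X = R.integrand X from rfl, hRi]
    simp only [soloInformedBoxR, soloInformedBoxW, soloInformedBoxU]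
    ring
  have : of r - of U = (of r - of R) + (of R - of R₁ - of R₂) - (of W - of R₂) - (of U - of R₁ - of W) := by
    abel
  rw [Equivalent, this]
  exact relations.sub_mem (relations.sub_mem (relations.add_mem e0 e1) e2) e3

end Summit.KontsevichZagierPeriods.KontsevichZagierPeriods.Theorems
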